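import Summits.BirchSwinnertonDyer.BirchSwinnertonDyer.Theorems.AdditiveKolyvaginRoadManinFrameResidueProperRTameTwistMod4
import Mathlib.NumberTheory.LegendreSymbol.QuadraticReciprocity
import HarnessLib

/-!
# Route `AdditiveKolyvaginRoad`, crux `ManinFrameResidueProperR` (stmt-BirchSwinnertonDyer-20709), line
# `birth`, stub TDS: quadratic-residue control of the auxiliary prime `d′` — `--supports`, helper

Cell `pub/bsd-wall`, seat `bsd-wall-manin-p1` g3. For the FULL tame-twist lever (no hypothesis on the
multiplicative primes) the auxiliary prime `d′ ≡ d (mod c)`, `d′ ≡ 3 (mod 4)` of `…RTameTwistMod4` must also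
make prescribed primes `ℓ ∣ N` (the RESONANT ones, `ℓ ≡ ±a_ℓ (mod p)`) squares resp. make `−ℓ` a square
modulo `d′`. By quadratic reciprocity (`d′ ≡ 3 (mod 4)`): `(ℓ/d′) = (−d′/ℓ) = (−d/ℓ)` (`ℓ ∣ c`), so these are
conditions on the class of `−d_γ` modulo `ℓ` — `legendre_aux` — and `exists_prime_eq_add_mul_of_adjustableL`
transports them. `pow_four_entry_sq_mod`: modulo any `ℓ ∣ (γ)₁₀`, `(γ⁴)₁₁ ≡ ((γ)₁₁)⁴`, a non-zero square.
Everything proved; no definition.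
-/

set_option autoImplicit false
set_option linter.dupNamespace false

noncomputable section

open scoped MatrixGroups Classical

open CongruenceSubgroup Matrix

namespace Summit.BirchSwinnertonDyer.BirchSwinnertonDyer.Theorems.ManinFrameResidueProperRTameTwist

section Reciprocity

/-- **Reciprocity for `d′ ≡ 3 (mod 4)`**: for odd primes `ℓ ≠ d′` with `d′ ≡ 3 (mod 4)`,
`(ℓ / d′) = (−d′ / ℓ)`. [folklore] -/
theorem legendreSym_eq_legendreSym_neg {d' ℓ : ℕ} [Fact d'.Prime] [Fact ℓ.Prime] (hd'4 : d' % 4 = 3)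
    (hℓ2 : ℓ ≠ 2) (hne : ℓ ≠ d') : legendreSym d' ℓ = legendreSym ℓ (-(d' : ℤ)) := by
  have hd'2 : d' ≠ 2 := by rintro rfl; norm_num at hd'4
  rw [show (-(d' : ℤ)) = (-1) * d' by ring, legendreSym.mul, legendreSym.at_neg_one hℓ2]
  rcases Nat.odd_mod_four_iff.mp ((Nat.Prime.mod_two_eq_one_iff_ne_two Fact.out).mpr hℓ2) with h1 | h3
  · rw [legendreSym.quadratic_reciprocity_one_mod_four h1 hd'2, ZMod.χ₄_nat_one_mod_four h1, one_mul]
  · rw [legendreSym.quadratic_reciprocity_three_mod_four h3 hd'4, ZMod.χ₄_nat_three_mod_four h3]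
    ring

/-- **From the class of `−d` mod `ℓ` to squares mod `d′`.** `d′ ≡ 3 (mod 4)` prime, `ℓ` an odd prime,
`ℓ < d′`, `d′ ≡ d (mod ℓ)`: if `−d` is a non-zero square mod `ℓ` then `ℓ` is a square mod `d′`; if `−d` is
a non-square mod `ℓ` then `−ℓ` is a square mod `d′`. [folklore] -/
theorem isSquare_mod_of_legendre {d' ℓ : ℕ} (hd' : d'.Prime) (hℓ : ℓ.Prime) (hd'4 : d' % 4 = 3)
    (hℓ2 : ℓ ≠ 2) (hℓd' : ℓ < d') {d : ℤ} (hmod : (ℓ : ℤ) ∣ (d' : ℤ) - d) (hd0 : ((d : ZMod ℓ)) ≠ 0) :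
    (IsSquare (-(d : ZMod ℓ)) → IsSquare ((ℓ : ZMod d'))) ∧
      (¬ IsSquare (-(d : ZMod ℓ)) → IsSquare (-(ℓ : ZMod d'))) := by
  haveI : Fact d'.Prime := ⟨hd'⟩
  haveI : Fact ℓ.Prime := ⟨hℓ⟩
  have hne : ℓ ≠ d' := hℓd'.ne
  have hd'2 : d' ≠ 2 := by rintro rfl; norm_num at hd'4
  have hcast : ((-(d' : ℤ) : ℤ) : ZMod ℓ) = ((-d : ℤ) : ZMod ℓ) := by
    have := (ZMod.intCast_eq_intCast_iff_dvd_sub d (d' : ℤ) ℓ).mpr (by simpa using hmod)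
    push_cast at this ⊢; rw [this]
  have hkey : legendreSym d' ℓ = legendreSym ℓ (-d) := by
    rw [legendreSym_eq_legendreSym_neg hd'4 hℓ2 hne, legendreSym, legendreSym, hcast]
  have hℓ0 : ((ℓ : ℤ) : ZMod d') ≠ 0 := by
    rw [Int.cast_natCast, Ne, ZMod.natCast_eq_zero_iff]
    exact fun h ↦ absurd (Nat.le_of_dvd hℓ.pos h) (not_le.mpr hℓd')
  have hnd0 : ((-d : ℤ) : ZMod ℓ) ≠ 0 := by push_cast; exact neg_ne_zero.mpr hd0
  constructor
  · intro hsq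
    have h1 : legendreSym ℓ (-d) = 1 := (legendreSym.eq_one_iff ℓ hnd0).mpr (by push_cast; exact hsq)
    have h2 : legendreSym d' ℓ = 1 := by rw [hkey, h1]
    have := (legendreSym.eq_one_iff d' hℓ0).mp h2
    simpa using this
  · intro hnsq
    have h1 : legendreSym ℓ (-d) = -1 := (legendreSym.eq_neg_one_iff ℓ).mpr (by push_cast; exact hnsq)
    have h2 : legendreSym d' ℓ = -1 := by rw [hkey, h1]
    have h3 : legendreSym d' (-(ℓ : ℤ)) = 1 := by
      rw [show (-(ℓ : ℤ)) = (-1) * ℓ by ring, legendreSym.mul, legendreSym.at_neg_one hd'2,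
        ZMod.χ₄_nat_three_mod_four hd'4, h2]; ring
    have hnℓ0 : ((-(ℓ : ℤ) : ℤ) : ZMod d') ≠ 0 := by rw [Int.cast_neg]; exact neg_ne_zero.mpr hℓ0
    have := (legendreSym.eq_one_iff d' hnℓ0).mp h3
    simpa using this

end Reciprocity

section PowFourL

/-- **`(γ⁴)₁₁ ≡ ((γ)₁₁)⁴` modulo any `ℓ ∣ (γ)₁₀`**, so it is a NON-ZERO SQUARE modulo a prime `ℓ ∣ c` (as
`gcd(c, d) = 1`). [folklore] -/
theorem pow_four_entry_isSquare {N : ℕ} (γ : Gamma0 N) {ℓ : ℕ} (hℓ : ℓ.Prime)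
    (hℓc : (ℓ : ℤ) ∣ (γ : SL(2, ℤ)) 1 0) :
    IsSquare ((((γ ^ 4 : Gamma0 N) : SL(2, ℤ)) 1 1 : ℤ) : ZMod ℓ) ∧
      ((((γ ^ 4 : Gamma0 N) : SL(2, ℤ)) 1 1 : ℤ) : ZMod ℓ) ≠ 0 := by
  haveI : Fact ℓ.Prime := ⟨hℓ⟩
  set f := Int.castRingHom (ZMod ℓ) with hf
  set A : Matrix (Fin 2) (Fin 2) (ZMod ℓ) := f.mapMatrix ((γ : SL(2, ℤ)) : Matrix (Fin 2) (Fin 2) ℤ)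
    with hA
  have hcoe : ((γ ^ 4 : Gamma0 N) : SL(2, ℤ)) = (γ : SL(2, ℤ)) ^ 4 := rfl
  have hpow : A ^ 4 = f.mapMatrix (((γ : SL(2, ℤ)) ^ 4 : SL(2, ℤ)) : Matrix (Fin 2) (Fin 2) ℤ) := by
    rw [Matrix.SpecialLinearGroup.coe_pow, map_pow]
  have hentry : ((((γ ^ 4 : Gamma0 N) : SL(2, ℤ)) 1 1 : ℤ) : ZMod ℓ) = (A ^ 4) 1 1 := by
    rw [hcoe, hpow]; rfl
  have hc0 : A 1 0 = 0 := by
    show (((((γ : SL(2, ℤ)) 1 0 : ℤ)) : ZMod ℓ)) = 0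
    exact (ZMod.intCast_zmod_eq_zero_iff_dvd _ ℓ).mpr hℓc
  -- an upper-triangular matrix: `(A⁴)₁₁ = (A₁₁)⁴`
  obtain ⟨a, b, c, d, hAeq⟩ : ∃ a b c d : ZMod ℓ, A = !![a, b; c, d] :=
    ⟨A 0 0, A 0 1, A 1 0, A 1 1, Matrix.eta_fin_two A⟩
  have hc : c = 0 := by
    have : A 1 0 = c := by rw [hAeq]; rfl
    rw [← this, hc0]
  have hd : A 1 1 = d := by rw [hAeq]; rfl
  have h44 : (A ^ 4) 1 1 = d ^ 4 := by
    rw [hAeq, hc, pow_succ, pow_succ, pow_succ, pow_one]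
    simp only [Matrix.mul_fin_two, Matrix.of_apply, Matrix.cons_val', Matrix.cons_val_zero,
      Matrix.cons_val_one]
    ring
  -- `d ≠ 0` from `a d − b c = 1`
  have hdet : A.det = 1 := by
    rw [hA, ← RingHom.map_det, (γ : SL(2, ℤ)).2, map_one]
  have hd0 : d ≠ 0 := by
    intro h0
    rw [hAeq, Matrix.det_fin_two_of, hc, h0] at hdet
    simp at hdet
  rw [hentry, h44]
  exact ⟨⟨d ^ 2, by ring⟩, pow_ne_zero 4 hd0⟩

end PowFourL

section PrimeDenominatorL

variable {N : ℕ} {p : ℕ}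

/-- **Dirichlet step with quadratic-residue control.** For a 4-adjustable `γ = (a b; c d) ∈ Γ₀(N)` (`p ∣ N`
prime) and a finite set `B` of odd primes dividing `N`: a prime `d′ = d + kc > N`, `d′ ≡ 3 (mod 4)`,
`p ∤ d′ − 1`, `r ∤ d′ − 1` (odd `r ∣ p − 1`), and for every `ℓ ∈ B`: `ℓ` is a square mod `d′` if `−d` is a
square mod `ℓ`, and `−ℓ` is a square mod `d′` otherwise (reciprocity, `d′ ≡ d (mod ℓ)`). [folklore] -/
theorem exists_prime_eq_add_mul_of_adjustableL [NeZero N] (hp : p.Prime) (hpN : p ∣ N) (γ : Gamma0 N)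
    (hc : (γ : SL(2, ℤ)) 1 0 ≠ 0) (hdp : ¬ (p : ℤ) ∣ (γ : SL(2, ℤ)) 1 1 - 1)
    (hdr : ∀ r : ℕ, r.Prime → r ≠ 2 → r ∣ p - 1 → (r : ℤ) ∣ (γ : SL(2, ℤ)) 1 0 →
      ¬ (r : ℤ) ∣ (γ : SL(2, ℤ)) 1 1 - 1)
    (h4 : (4 : ℤ) ∣ (γ : SL(2, ℤ)) 1 0 → (4 : ℤ) ∣ (γ : SL(2, ℤ)) 1 1 - 3)
    (B : Finset ℕ) (hB : ∀ ℓ ∈ B, ℓ.Prime ∧ ℓ ≠ 2 ∧ ℓ ∣ N) :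
    ∃ (k : ℤ) (d' : ℕ), d'.Prime ∧ N < d' ∧ ((d' : ℤ) = (γ : SL(2, ℤ)) 1 1 + k * (γ : SL(2, ℤ)) 1 0) ∧
      ¬ p ∣ d' - 1 ∧ (∀ r : ℕ, r.Prime → r ≠ 2 → r ∣ p - 1 → ¬ r ∣ d' - 1) ∧ ¬ 4 ∣ d' - 1 ∧
      ∀ ℓ ∈ B, (IsSquare (-(((γ : SL(2, ℤ)) 1 1 : ℤ) : ZMod ℓ)) → IsSquare ((ℓ : ZMod d'))) ∧
        (¬ IsSquare (-(((γ : SL(2, ℤ)) 1 1 : ℤ) : ZMod ℓ)) → IsSquare (-(ℓ : ZMod d'))) := by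
  obtain ⟨k, d', hd', hNd', hd'eq, hpd', hrd', h4d'⟩ :=
    exists_prime_eq_add_mul_of_adjustable4 hp hpN γ hc hdp hdr h4
  refine ⟨k, d', hd', hNd', hd'eq, hpd', hrd', h4d', fun ℓ hℓ ↦ ?_⟩
  obtain ⟨hℓp, hℓ2, hℓN⟩ := hB ℓ hℓ
  have hN0 : N ≠ 0 := NeZero.ne N
  have hℓd' : ℓ < d' := (Nat.le_of_dvd (Nat.pos_of_ne_zero hN0) hℓN).trans_lt hNd'
  -- `d′ ≡ 3 (mod 4)`
  have hd'odd : d' % 2 = 1 := by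
    refine (Nat.Prime.mod_two_eq_one_iff_ne_two hd').mpr ?_
    rintro rfl
    have : p ≤ N := Nat.le_of_dvd (Nat.pos_of_ne_zero hN0) hpN
    have := hp.two_le; omega
  have hd'4 : d' % 4 = 3 := by
    rcases Nat.odd_mod_four_iff.mp hd'odd with h1 | h3
    · exfalso; apply h4d'; have := Nat.div_add_mod d' 4; omega
    · exact h3
  -- `ℓ ∣ c`, so `ℓ ∣ d′ − d`, and `d` is a unit mod `ℓ`
  have hℓc : (ℓ : ℤ) ∣ (γ : SL(2, ℤ)) 1 0 := (Int.natCast_dvd_natCast.mpr hℓN).trans (natCast_dvd_entry10 γ)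
  have hmod : (ℓ : ℤ) ∣ (d' : ℤ) - (γ : SL(2, ℤ)) 1 1 := by
    rw [hd'eq, show (γ : SL(2, ℤ)) 1 1 + k * (γ : SL(2, ℤ)) 1 0 - (γ : SL(2, ℤ)) 1 1 =
      k * (γ : SL(2, ℤ)) 1 0 by ring]
    exact hℓc.mul_left k
  have hd0 : ((((γ : SL(2, ℤ)) 1 1 : ℤ)) : ZMod ℓ) ≠ 0 := by
    intro h0
    have hℓd : (ℓ : ℤ) ∣ (γ : SL(2, ℤ)) 1 1 := (ZMod.intCast_zmod_eq_zero_iff_dvd _ ℓ).mp h0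
    have hdet := entry_det γ
    have : (ℓ : ℤ) ∣ (γ : SL(2, ℤ)) 0 0 * (γ : SL(2, ℤ)) 1 1 - (γ : SL(2, ℤ)) 0 1 * (γ : SL(2, ℤ)) 1 0 :=
      dvd_sub (hℓd.mul_left _) (hℓc.mul_left _)
    rw [hdet] at this
    exact hℓp.one_lt.ne' (by exact_mod_cast Int.eq_one_of_dvd_one (Int.natCast_nonneg ℓ) this)
  exact isSquare_mod_of_legendre hd' hℓp hd'4 hℓ2 hℓd' hmod hd0

end PrimeDenominatorL

end Summit.BirchSwinnertonDyer.BirchSwinnertonDyer.Theorems.ManinFrameResidueProperRTameTwist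

end
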